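import Literature.NumberTheory.Sieve.HeathBrownCubicNormSublevel
import HarnessLib

/-!
# Heath-Brown's (8.5) for `n = 0`: residue-class sums of the indicator `w'(N(β))` over a cube

Layer of the decomposition of **parity.S18**
(`Literature.NumberTheory.Sieve.setOf_prime_cube_add_two_mul_cube_infinite`) along D. R. Heath-Brown,
*Primes represented by `x³ + 2y³`*, Acta Math. 186 (2001), 1–84, completing `HeathBrownCubicCubeSums`
((8.5) for `n ≥ 1`) with the case `n = 0` of (8.5) (pp. 49–50), where `w'(·, 𝐦)` for `𝐦 = (m₁)` is the
indicator function of `J(m₁) = [X^{m₁ξ}, X^{(m₁+1)ξ})` and the Lipschitz estimate (8.3) is replaced by a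
count of the cells on which `N` crosses one of the two levels:

> "Here we find that `w'(t, 𝐦)` is just the characteristic function of `J(m₁)`. … If we write,
> temporarily, `J(m₁) = [a, b)`, we find that `w'(N(β)) = r⁻³∫_{C(β)} w'(N(𝐱)) dxdydz` unless `N(𝐱) = a`
> or `b`, for some `𝐱 ∈ C(β)`. Since `𝐱·∇N(𝐱) = 3N(𝐱) ≫ V` (8.6), we have `|∇N(𝐱)| ≫ V^{2/3}`, so that
> Lemma 4.9 may be applied … The number of cubes for which (8.6) fails is therefore `O(S₀²r⁻²)`, whence
> we may deduce as before that `∑_{β̂ ∈ 𝒞, β ≡ γ (mod r)} w'(N(β)) = r⁻³∑∫_{C(β)} w'(N(𝐱)) + O(S₀²r⁻²) = r⁻³𝓘 + O(S₀²r⁻²)`.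
> Thus (8.5) holds for `n = 0` too."

This file PROVES:

* `abs_sum_latticeCube_sub_integral_le_of_set` — the abstract comparison of `HeathBrownCubicCubeSums`
  with the Lipschitz hypothesis replaced by an exceptional set: if `|g| ≤ B` on `𝒞` and `g(𝐱) ≠ g(𝐲)`
  for `𝐱, 𝐲 ∈ 𝒞` within `r` of each other in every coordinate forces `𝐲 ∈ T`, then
  `|∑_{v ∈ 𝒞 ∩ (γ + rℤ³)} g(v) − r⁻³∫_𝒞 g| ≤ r⁻³·2B·vol(T) + 108(S₀/r)²B` (interior cells contribute
  `≤ 2B vol(C ∩ T)` each and are disjoint);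
* **`HeathBrown2001_eq_8_5_zero`** — (8.5) for `𝐦` of length one, with explicit constants: for a cube
  satisfying `CubeCond c₃ c₄ V` (`c₃, c₄, V > 0`), `X ≥ 1`, `τ ≥ 0`, `1 ≤ r ≤ S₀`,
  `|∑_{β̂ ∈ 𝒞, β̂ ≡ γ̂ (mod r)} w'(N(β̂)) − r⁻³𝓘| ≤ (2808c₃³/c₄ + 108)S₀²/r²`. The exceptional set is
  `{𝐱 ∈ 𝒞 : |N(𝐱) − a| ≤ δ or |N(𝐱) − b| ≤ δ}` with `δ = 39(c₃V^{1/3})²r ≥ |N(𝐱) − N(𝐲)|`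
  (`abs_normForm_sub_le`), of volume `≤ 2·18δS₀²c₃V^{1/3}/(c₄V) = 1404(c₃³/c₄)S₀²r` by
  `volume_normForm_near_le` of `HeathBrownCubicNormSublevel` — this measure bound stands in for the
  paper's appeal to the general Lemma 4.9 and gives the same `O(S₀²r⁻²)`.

## References

* D. R. Heath-Brown, *Primes represented by `x³ + 2y³`*, Acta Math. 186 (2001), 1–84: §8, the
  paragraph containing (8.6) (pp. 49–50). [cite: HeathBrownActa2001, §8 (8.5)–(8.6)]

## Mathlib / tree search

Mathlib: `setIntegral_mono_on`, `setIntegral_indicator`, `abs_integral_le_integral_abs`,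
`measure_biUnion_finset`, `ENNReal.toReal_sum`. Tree: `HeathBrownCubicCubeSums` (cells, windows,
`integral_realCube_eq_sum_cells`, `card_filter_not_cellInterior₃_le`, `sum_latticeCube_filter_modEq_eq`,
`abs_normForm_sub_le`, `integrableOn_wDeriv_normForm`, `castVec`), `HeathBrownCubicNormSublevel`
(`volume_normForm_near_le`), `HeathBrownCubicWCalculus` (`wDeriv_eq_indicator`), `HeathBrownCubicTypeII`
(`CubeCond`, `latticeCube`, `wDeriv`, `hbXi`), `HeathBrownCubicSiegelWalfisz` (`normForm`, `cubeIntegral`).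
-/

noncomputable section

open MeasureTheory Set Filter Topology Finset

namespace Literature.NumberTheory.Sieve.CubicSieve

/-! ### The abstract comparison with an exceptional set in place of a Lipschitz bound -/

section AbstractSet

variable {a : ℝ × ℝ × ℝ} {S₀ : ℝ} {γ : ℤ × ℤ × ℤ} {r : ℕ}

open scoped Classical in
/-- **Riemann sums over a class `γ + rℤ³` in a cube, for a weight that is locally constant off an
exceptional set** (the mechanism of (8.5) for `n = 0`, p. 49: "`w'(N(β)) = r⁻³∫_{C(β)} w'(N(𝐱)) dxdydz`
unless `N(𝐱) = a` or `b`, for some `𝐱 ∈ C(β)`"). For a cube `𝒞 = ∏ (a_j, a_j + S₀]`, `1 ≤ r ≤ S₀`, `g`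
integrable on `𝒞` with `|g| ≤ B` on `𝒞`, and a measurable set `T` of finite measure such that
`g(𝐱) ≠ g(𝐲)` for `𝐱, 𝐲 ∈ 𝒞` within `r` of each other in every coordinate forces `𝐲 ∈ T`:
`|∑_{v ∈ 𝒞 ∩ (γ + rℤ³)} g(v) − r⁻³∫_𝒞 g| ≤ r⁻³ · 2B · vol(T) + 108(S₀/r)²B`
(an interior cell `C` contributes `|r³g(v) − ∫_C g| ≤ 2B vol(C ∩ T)`, and the cells are disjoint).
[folklore] -/
theorem abs_sum_cellVertex_sub_integral_le_of_set (hr : 0 < r) (hrS : (r : ℝ) ≤ S₀)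
    {g : ℝ × ℝ × ℝ → ℝ} (hg : IntegrableOn g (realCube a S₀)) {B : ℝ} (hB0 : 0 ≤ B)
    (hB : ∀ x ∈ realCube a S₀, |g x| ≤ B) {T : Set (ℝ × ℝ × ℝ)} (hT : MeasurableSet T)
    (hTfin : volume T ≠ ⊤)
    (hgT : ∀ x ∈ realCube a S₀, ∀ y ∈ realCube a S₀, |x.1 - y.1| ≤ r → |x.2.1 - y.2.1| ≤ r →
      |x.2.2 - y.2.2| ≤ r → g x ≠ g y → y ∈ T) :
    |∑ w ∈ (cellWindow₃ a S₀ γ r).filter (fun w => cellVertex₃ γ r w ∈ realCube a S₀),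
          g (cellVertex₃ γ r w) -
        ((r : ℝ) ^ 3)⁻¹ * ∫ x in realCube a S₀, g x| ≤
      ((r : ℝ) ^ 3)⁻¹ * (2 * B * (volume T).toReal) + 108 * (S₀ / r) ^ 2 * B := by
  have hr' : (0 : ℝ) < r := by exact_mod_cast hr
  have hS₀ : 0 < S₀ := hr'.trans_le hrS
  have hr3 : (0 : ℝ) < (r : ℝ) ^ 3 := by positivity
  set W := cellWindow₃ a S₀ γ r with hW
  set 𝒞 := realCube a S₀ with h𝒞
  set V : ℤ × ℤ × ℤ → ℝ × ℝ × ℝ := fun w => cellVertex₃ γ r w with hV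
  have hI : ∫ x in 𝒞, g x = ∑ w ∈ W, ∫ x in cell₃ γ r w ∩ 𝒞, g x :=
    integral_realCube_eq_sum_cells hr hg
  have hS : ∑ w ∈ W.filter (fun w => V w ∈ 𝒞), g (V w) =
      ∑ w ∈ W, if V w ∈ 𝒞 then g (V w) else 0 := Finset.sum_filter _ _
  set D : ℤ × ℤ × ℤ → ℝ := fun w =>
    (r : ℝ) ^ 3 * (if V w ∈ 𝒞 then g (V w) else 0) - ∫ x in cell₃ γ r w ∩ 𝒞, g x with hD
  have hkey : (r : ℝ) ^ 3 * ∑ w ∈ W.filter (fun w => V w ∈ 𝒞), g (V w) - ∫ x in 𝒞, g x =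
      ∑ w ∈ W, D w := by
    rw [hS, hI, Finset.mul_sum, ← Finset.sum_sub_distrib]
  -- volumes
  have hvol : ∀ w, volume (cell₃ γ r w ∩ 𝒞) ≤ ENNReal.ofReal ((r : ℝ) ^ 3) := fun w =>
    (measure_mono Set.inter_subset_left).trans_eq (volume_cell₃ γ r w)
  have hvol_lt : ∀ w, volume (cell₃ γ r w ∩ 𝒞) < ⊤ := fun w =>
    (hvol w).trans_lt ENNReal.ofReal_lt_top
  have hreal : ∀ w, (volume (cell₃ γ r w ∩ 𝒞)).toReal ≤ (r : ℝ) ^ 3 := fun w => by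
    have := ENNReal.toReal_mono ENNReal.ofReal_ne_top (hvol w)
    rwa [ENNReal.toReal_ofReal hr3.le] at this
  -- every cell: `|D w| ≤ 2r³B`
  have hDall : ∀ w ∈ W, |D w| ≤ 2 * (r : ℝ) ^ 3 * B := by
    intro w _
    have h1 : |(r : ℝ) ^ 3 * (if V w ∈ 𝒞 then g (V w) else 0)| ≤ (r : ℝ) ^ 3 * B := by
      rw [abs_mul, abs_of_pos hr3]
      refine mul_le_mul_of_nonneg_left ?_ hr3.le
      split_ifs with h
      · exact hB _ h
      · simpa using hB0
    have h2 : |∫ x in cell₃ γ r w ∩ 𝒞, g x| ≤ (r : ℝ) ^ 3 * B := by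
      have := norm_setIntegral_le_of_norm_le_const (hvol_lt w)
        (fun x hx => show ‖g x‖ ≤ B by rw [Real.norm_eq_abs]; exact hB x hx.2)
      rw [Real.norm_eq_abs, measureReal_def] at this
      calc |∫ x in cell₃ γ r w ∩ 𝒞, g x| ≤ B * (volume (cell₃ γ r w ∩ 𝒞)).toReal := this
        _ ≤ B * (r : ℝ) ^ 3 := mul_le_mul_of_nonneg_left (hreal w) hB0
        _ = (r : ℝ) ^ 3 * B := mul_comm _ _
    calc |D w| ≤ |(r : ℝ) ^ 3 * (if V w ∈ 𝒞 then g (V w) else 0)| +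
          |∫ x in cell₃ γ r w ∩ 𝒞, g x| := abs_sub _ _
      _ ≤ (r : ℝ) ^ 3 * B + (r : ℝ) ^ 3 * B := add_le_add h1 h2
      _ = 2 * (r : ℝ) ^ 3 * B := by ring
  -- interior cells: `|D w| ≤ 2B vol(cell ∩ T)`
  have hDint : ∀ w ∈ W, CellInterior₃ a S₀ γ r w →
      |D w| ≤ 2 * B * (volume (cell₃ γ r w ∩ T)).toReal := by
    intro w _ hint
    have hsub : cell₃ γ r w ⊆ 𝒞 := cell₃_subset_realCube hint
    have hVcell : V w ∈ cell₃ γ r w := cellVertex₃_mem_cell₃ γ hr w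
    have hV𝒞 : V w ∈ 𝒞 := hsub hVcell
    have hinter : cell₃ γ r w ∩ 𝒞 = cell₃ γ r w := Set.inter_eq_left.mpr hsub
    have hvolw : (volume (cell₃ γ r w)).toReal = (r : ℝ) ^ 3 := by
      rw [volume_cell₃, ENNReal.toReal_ofReal hr3.le]
    have hconst : ∫ _ in cell₃ γ r w, g (V w) = (r : ℝ) ^ 3 * g (V w) := by
      rw [setIntegral_const, measureReal_def, hvolw, smul_eq_mul]
    have hgi : IntegrableOn g (cell₃ γ r w) := hg.mono_set hsub
    have hci : IntegrableOn (fun _ => g (V w)) (cell₃ γ r w) :=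
      integrableOn_const (volume_cell₃_lt_top γ r w).ne
    have hDw : D w = ∫ x in cell₃ γ r w, (g (V w) - g x) := by
      simp only [hD, if_pos hV𝒞, hinter]
      rw [integral_sub hci hgi, hconst]
    rw [hDw]
    -- pointwise: `|g(V w) − g(x)| ≤ 2B·1_T(x)` on the cell
    have hpt : ∀ x ∈ cell₃ γ r w, |g (V w) - g x| ≤ T.indicator (fun _ => 2 * B) x := by
      intro x hx
      by_cases hgx : g (V w) = g x
      · rw [hgx, sub_self, abs_zero]
        exact Set.indicator_nonneg (fun _ _ => by positivity) x
      · obtain ⟨d1, d2, d3⟩ := abs_sub_cellVertex₃_le hx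
        have hxT : x ∈ T := hgT (V w) hV𝒞 x (hsub hx) (by rw [abs_sub_comm]; exact d1)
          (by rw [abs_sub_comm]; exact d2) (by rw [abs_sub_comm]; exact d3) hgx
        rw [Set.indicator_of_mem hxT]
        calc |g (V w) - g x| ≤ |g (V w)| + |g x| := abs_sub _ _
          _ ≤ B + B := add_le_add (hB _ hV𝒞) (hB _ (hsub hx))
          _ = 2 * B := by ring
    have hint_ind : IntegrableOn (T.indicator fun _ => (2 * B : ℝ)) (cell₃ γ r w) :=
      (integrableOn_const (volume_cell₃_lt_top γ r w).ne).indicator hT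
    calc |∫ x in cell₃ γ r w, (g (V w) - g x)| ≤ ∫ x in cell₃ γ r w, |g (V w) - g x| :=
          abs_integral_le_integral_abs
      _ ≤ ∫ x in cell₃ γ r w, T.indicator (fun _ => 2 * B) x :=
          setIntegral_mono_on (hci.sub hgi).abs hint_ind (measurableSet_cell₃ γ r w) hpt
      _ = 2 * B * (volume (cell₃ γ r w ∩ T)).toReal := by
          rw [setIntegral_indicator hT, setIntegral_const, measureReal_def, smul_eq_mul, mul_comm]
  -- the interior total: disjoint cells, so at most `2B vol(T)`
  have hint_sum : ∑ w ∈ W.filter (fun w => CellInterior₃ a S₀ γ r w),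
      2 * B * (volume (cell₃ γ r w ∩ T)).toReal ≤ 2 * B * (volume T).toReal := by
    set Wi := W.filter (fun w => CellInterior₃ a S₀ γ r w) with hWi
    have hdisj : Set.PairwiseDisjoint (↑Wi : Set (ℤ × ℤ × ℤ)) (fun w => cell₃ γ r w ∩ T) :=
      fun w _ w' _ hne => (disjoint_cell₃ γ r hne).mono Set.inter_subset_left Set.inter_subset_left
    have hmeas : ∀ w ∈ Wi, MeasurableSet (cell₃ γ r w ∩ T) := fun w _ => (measurableSet_cell₃ γ r w).inter hT
    have hunion : volume (⋃ w ∈ Wi, cell₃ γ r w ∩ T) = ∑ w ∈ Wi, volume (cell₃ γ r w ∩ T) :=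
      measure_biUnion_finset hdisj hmeas
    have hle : volume (⋃ w ∈ Wi, cell₃ γ r w ∩ T) ≤ volume T :=
      measure_mono (Set.iUnion₂_subset fun w _ => Set.inter_subset_right)
    have hfin : ∀ w ∈ Wi, volume (cell₃ γ r w ∩ T) ≠ ⊤ := fun w _ =>
      ((measure_mono Set.inter_subset_right).trans_lt hTfin.lt_top).ne
    rw [← Finset.mul_sum, ← ENNReal.toReal_sum hfin, ← hunion]
    exact mul_le_mul_of_nonneg_left (ENNReal.toReal_mono hTfin hle) (by positivity)
  -- summing up
  have hsum : |∑ w ∈ W, D w| ≤ 2 * B * (volume T).toReal +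
      ((W.filter fun w => ¬CellInterior₃ a S₀ γ r w).card : ℝ) * (2 * (r : ℝ) ^ 3 * B) := by
    calc |∑ w ∈ W, D w| ≤ ∑ w ∈ W, |D w| := Finset.abs_sum_le_sum_abs _ _
      _ = ∑ w ∈ W.filter (fun w => CellInterior₃ a S₀ γ r w), |D w| +
            ∑ w ∈ W.filter (fun w => ¬CellInterior₃ a S₀ γ r w), |D w| :=
          (Finset.sum_filter_add_sum_filter_not _ _ _).symm
      _ ≤ ∑ w ∈ W.filter (fun w => CellInterior₃ a S₀ γ r w), 2 * B * (volume (cell₃ γ r w ∩ T)).toReal +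
            ∑ w ∈ W.filter (fun w => ¬CellInterior₃ a S₀ γ r w), 2 * (r : ℝ) ^ 3 * B := by
          gcongr with w hw w hw
          · rw [Finset.mem_filter] at hw; exact hDint w hw.1 hw.2
          · rw [Finset.mem_filter] at hw; exact hDall w hw.1
      _ ≤ 2 * B * (volume T).toReal +
            ((W.filter fun w => ¬CellInterior₃ a S₀ γ r w).card : ℝ) * (2 * (r : ℝ) ^ 3 * B) := by
          rw [Finset.sum_const, nsmul_eq_mul]
          exact add_le_add hint_sum le_rfl
  have hBc : ((W.filter fun w => ¬CellInterior₃ a S₀ γ r w).card : ℝ) ≤ 6 * (S₀ / r + 2) ^ 2 :=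
    card_filter_not_cellInterior₃_le hS₀.le hr
  have hratio : 1 ≤ S₀ / r := by rwa [le_div_iff₀ hr', one_mul]
  have h3 : S₀ / r + 2 ≤ 3 * (S₀ / r) := by linarith
  have h0 : 0 ≤ S₀ / r + 2 := by positivity
  have hfinal : |(r : ℝ) ^ 3 * ∑ w ∈ W.filter (fun w => V w ∈ 𝒞), g (V w) - ∫ x in 𝒞, g x| ≤
      2 * B * (volume T).toReal + (r : ℝ) ^ 3 * (108 * (S₀ / r) ^ 2 * B) := by
    rw [hkey]
    calc |∑ w ∈ W, D w| ≤ 2 * B * (volume T).toReal +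
          ((W.filter fun w => ¬CellInterior₃ a S₀ γ r w).card : ℝ) * (2 * (r : ℝ) ^ 3 * B) := hsum
      _ ≤ 2 * B * (volume T).toReal + 6 * (S₀ / r + 2) ^ 2 * (2 * (r : ℝ) ^ 3 * B) := by gcongr
      _ ≤ 2 * B * (volume T).toReal + 6 * (3 * (S₀ / r)) ^ 2 * (2 * (r : ℝ) ^ 3 * B) := by gcongr
      _ = 2 * B * (volume T).toReal + (r : ℝ) ^ 3 * (108 * (S₀ / r) ^ 2 * B) := by ring
  have heq : ∑ w ∈ W.filter (fun w => V w ∈ 𝒞), g (V w) - ((r : ℝ) ^ 3)⁻¹ * ∫ x in 𝒞, g x =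
      ((r : ℝ) ^ 3)⁻¹ *
        ((r : ℝ) ^ 3 * ∑ w ∈ W.filter (fun w => V w ∈ 𝒞), g (V w) - ∫ x in 𝒞, g x) := by
    rw [mul_sub, ← mul_assoc, inv_mul_cancel₀ hr3.ne', one_mul]
  rw [heq, abs_mul, abs_of_pos (inv_pos.mpr hr3)]
  calc ((r : ℝ) ^ 3)⁻¹ * |(r : ℝ) ^ 3 * ∑ w ∈ W.filter (fun w => V w ∈ 𝒞), g (V w) - ∫ x in 𝒞, g x|
      ≤ ((r : ℝ) ^ 3)⁻¹ * (2 * B * (volume T).toReal + (r : ℝ) ^ 3 * (108 * (S₀ / r) ^ 2 * B)) :=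
        mul_le_mul_of_nonneg_left hfinal (inv_pos.mpr hr3).le
    _ = ((r : ℝ) ^ 3)⁻¹ * (2 * B * (volume T).toReal) + 108 * (S₀ / r) ^ 2 * B := by
        field_simp

open scoped Classical in
/-- The exceptional-set comparison for the lattice sum `∑_{v ∈ 𝒞 ∩ ℤ³, v ≡ γ (mod r)} g(v)` itself.
[folklore] -/
theorem abs_sum_latticeCube_sub_integral_le_of_set (hr : 0 < r) (hrS : (r : ℝ) ≤ S₀)
    {g : ℝ × ℝ × ℝ → ℝ} (hg : IntegrableOn g (realCube a S₀)) {B : ℝ} (hB0 : 0 ≤ B)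
    (hB : ∀ x ∈ realCube a S₀, |g x| ≤ B) {T : Set (ℝ × ℝ × ℝ)} (hT : MeasurableSet T)
    (hTfin : volume T ≠ ⊤)
    (hgT : ∀ x ∈ realCube a S₀, ∀ y ∈ realCube a S₀, |x.1 - y.1| ≤ r → |x.2.1 - y.2.1| ≤ r →
      |x.2.2 - y.2.2| ≤ r → g x ≠ g y → y ∈ T) :
    |∑ v ∈ (latticeCube a S₀).filter
          (fun v => (r : ℤ) ∣ v.1 - γ.1 ∧ (r : ℤ) ∣ v.2.1 - γ.2.1 ∧ (r : ℤ) ∣ v.2.2 - γ.2.2),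
          g (castVec v) -
        ((r : ℝ) ^ 3)⁻¹ * ∫ x in realCube a S₀, g x| ≤
      ((r : ℝ) ^ 3)⁻¹ * (2 * B * (volume T).toReal) + 108 * (S₀ / r) ^ 2 * B := by
  rw [sum_latticeCube_filter_modEq_eq hr]
  simp only [castVec_intVertex]
  exact abs_sum_cellVertex_sub_integral_le_of_set hr hrS hg hB0 hB hT hTfin hgT

end AbstractSet

/-! ### (8.5) for `n = 0`: the weight `w'` is the indicator of `J(m₁)` -/

section EightFiveZero

variable {X τ : ℝ} {a : ℝ × ℝ × ℝ} {S₀ : ℝ}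

/-- The part of the cube where `N` is within `δ` of a level is measurable. [folklore] -/
theorem measurableSet_normForm_near (a : ℝ × ℝ × ℝ) (S₀ A δ : ℝ) :
    MeasurableSet {p : ℝ × ℝ × ℝ | p ∈ realCube a S₀ ∧ |normForm p - A| ≤ δ} :=
  (measurableSet_realCube a S₀).inter
    (measurableSet_le ((continuous_normForm.sub continuous_const).abs).measurable measurable_const)

open scoped Classical in
/-- **Heath-Brown's (8.5) for `n = 0`** (pp. 49–50): for `𝐦 = (m₁)` of length one `w'(t, 𝐦)` is the
indicator function of `J(m₁) = [a, b)` (p. 49), and "`w'(N(β)) = r⁻³∫_{C(β)} w'(N(𝐱)) dxdydz` unless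
`N(𝐱) = a` or `b`, for some `𝐱 ∈ C(β)`. Since `𝐱·∇N(𝐱) = 3N(𝐱) ≫ V` (8.6), we have `|∇N(𝐱)| ≫ V^{2/3}`
… The number of cubes for which (8.6) fails is therefore `O(S₀²r⁻²)`, whence we may deduce as before
that `∑_{β̂ ∈ 𝒞, β ≡ γ (mod r)} w'(N(β)) = r⁻³𝓘 + O(S₀²r⁻²)`. Thus (8.5) holds for `n = 0` too." Here with
explicit constants, for a cube satisfying `CubeCond c₃ c₄ V` (`c₃, c₄, V > 0`), `X ≥ 1`, `τ ≥ 0`,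
`1 ≤ r ≤ S₀`: `|∑_{β̂ ∈ 𝒞, β̂ ≡ γ̂ (mod r)} w'(N(β̂)) − r⁻³𝓘| ≤ (2808c₃³/c₄ + 108)S₀²/r²`. The appeal to
Lemma 4.9 (a count of cells meeting a level surface) is replaced by the measure bound
`volume_normForm_near_le` of `HeathBrownCubicNormSublevel`: a cell on which the indicator is not
constant lies, up to its vertex, inside the set where `N` is within `39(c₃V^{1/3})²r` of `a` or of `b`
(`abs_sum_latticeCube_sub_integral_le_of_set`). [cite: HeathBrownActa2001, §8 (8.5)] -/
theorem HeathBrown2001_eq_8_5_zero (hX : 1 ≤ X) (hτ : 0 ≤ τ) (m : Fin 1 → ℕ)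
    {c₃ c₄ V : ℝ} (hc₃ : 0 < c₃) (hc₄ : 0 < c₄) (hV : 0 < V)
    (hcube : CubeCond c₃ c₄ V a S₀) {r : ℕ} (hr : 0 < r) (hrS : (r : ℝ) ≤ S₀) (γ : ℤ × ℤ × ℤ) :
    |∑ v ∈ (latticeCube a S₀).filter
          (fun v => (r : ℤ) ∣ v.1 - γ.1 ∧ (r : ℤ) ∣ v.2.1 - γ.2.1 ∧ (r : ℤ) ∣ v.2.2 - γ.2.2),
          wDeriv X τ m (normForm (castVec v)) -
        ((r : ℝ) ^ 3)⁻¹ * cubeIntegral X τ m a S₀| ≤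
      (2808 * (c₃ ^ 3 / c₄) + 108) * (S₀ ^ 2 / r ^ 2) := by
  have hX0 : 0 < X := by linarith
  have hr' : (0 : ℝ) < r := by exact_mod_cast hr
  have hS₀ : 0 < S₀ := hr'.trans_le hrS
  set A : ℝ := X ^ ((m 0 : ℝ) * hbXi τ) with hA
  set Bh : ℝ := X ^ (((m 0 : ℝ) + 1) * hbXi τ) with hBh
  set g : ℝ × ℝ × ℝ → ℝ := fun p => wDeriv X τ m (normForm p) with hg
  have hg_ind : ∀ p, g p = if A ≤ normForm p ∧ normForm p < Bh then 1 else 0 := fun p =>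
    wDeriv_eq_indicator hX0 m _
  have hB : ∀ x ∈ realCube a S₀, |g x| ≤ 1 := fun x _ => by
    rw [hg_ind]; split_ifs <;> simp
  set R : ℝ := c₃ * V ^ (1 / 3 : ℝ) with hR
  have hRpos : 0 < R := by positivity
  set δ : ℝ := 39 * R ^ 2 * r with hδ
  have hδ0 : 0 ≤ δ := by positivity
  set T : Set (ℝ × ℝ × ℝ) := {p | p ∈ realCube a S₀ ∧ |normForm p - A| ≤ δ} ∪
    {p | p ∈ realCube a S₀ ∧ |normForm p - Bh| ≤ δ} with hT
  have hTm : MeasurableSet T :=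
    (measurableSet_normForm_near a S₀ A δ).union (measurableSet_normForm_near a S₀ Bh δ)
  -- the measure of the exceptional set
  have hvolA := volume_normForm_near_le (a := a) hc₃ hc₄ hV hS₀.le hcube A hδ0
  have hvolB := volume_normForm_near_le (a := a) hc₃ hc₄ hV hS₀.le hcube Bh hδ0
  have hbound : 18 * δ * S₀ ^ 2 * (c₃ * V ^ (1 / 3 : ℝ)) / (c₄ * V) = 702 * (c₃ ^ 3 / c₄) * r * S₀ ^ 2 := by
    have hR3 : (V ^ (1 / 3 : ℝ)) ^ 3 = V := by
      rw [← Real.rpow_natCast, ← Real.rpow_mul hV.le]; norm_num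
    rw [hδ, hR]
    field_simp
    nlinarith [hR3]
  have hvolT : volume T ≤ ENNReal.ofReal (1404 * (c₃ ^ 3 / c₄) * r * S₀ ^ 2) := by
    have h702 : 0 ≤ 702 * (c₃ ^ 3 / c₄) * r * S₀ ^ 2 := by positivity
    calc volume T ≤ volume {p | p ∈ realCube a S₀ ∧ |normForm p - A| ≤ δ} +
          volume {p | p ∈ realCube a S₀ ∧ |normForm p - Bh| ≤ δ} := measure_union_le _ _
      _ ≤ ENNReal.ofReal (702 * (c₃ ^ 3 / c₄) * r * S₀ ^ 2) +
          ENNReal.ofReal (702 * (c₃ ^ 3 / c₄) * r * S₀ ^ 2) := by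
          rw [← hbound]; exact add_le_add hvolA hvolB
      _ = ENNReal.ofReal (1404 * (c₃ ^ 3 / c₄) * r * S₀ ^ 2) := by
          rw [← ENNReal.ofReal_add h702 h702]; congr 1; ring
  have hTfin : volume T ≠ ⊤ := (hvolT.trans_lt ENNReal.ofReal_lt_top).ne
  have hTreal : (volume T).toReal ≤ 1404 * (c₃ ^ 3 / c₄) * r * S₀ ^ 2 := by
    have := ENNReal.toReal_mono ENNReal.ofReal_ne_top hvolT
    rwa [ENNReal.toReal_ofReal (by positivity)] at this
  -- locally constant off `T`
  have hgT : ∀ x ∈ realCube a S₀, ∀ y ∈ realCube a S₀, |x.1 - y.1| ≤ r → |x.2.1 - y.2.1| ≤ r →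
      |x.2.2 - y.2.2| ≤ r → g x ≠ g y → y ∈ T := by
    intro x hx y hy h1 h2 h3 hne
    obtain ⟨hx1, hx2, hx3, -⟩ := hcube x hx
    obtain ⟨hy1, hy2, hy3, -⟩ := hcube y hy
    have hN : |normForm x - normForm y| ≤ δ :=
      abs_normForm_sub_le (R := R) (δ := r) ⟨hx1, hx2, hx3⟩ ⟨hy1, hy2, hy3⟩ ⟨h1, h2, h3⟩
    rw [abs_le] at hN
    rw [hg_ind x, hg_ind y] at hne
    by_cases hxin : A ≤ normForm x ∧ normForm x < Bh
    · by_cases hyin : A ≤ normForm y ∧ normForm y < Bh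
      · rw [if_pos hxin, if_pos hyin] at hne; exact absurd rfl hne
      · rcases not_and_or.mp hyin with hyA | hyB
        · left; exact ⟨hy, abs_le.mpr ⟨by linarith [not_le.mp hyA], by linarith [not_le.mp hyA]⟩⟩
        · right; exact ⟨hy, abs_le.mpr ⟨by linarith [not_lt.mp hyB], by linarith [not_lt.mp hyB]⟩⟩
    · by_cases hyin : A ≤ normForm y ∧ normForm y < Bh
      · rcases not_and_or.mp hxin with hxA | hxB
        · left; exact ⟨hy, abs_le.mpr ⟨by linarith [not_le.mp hxA], by linarith [not_le.mp hxA]⟩⟩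
        · right; exact ⟨hy, abs_le.mpr ⟨by linarith [not_lt.mp hxB], by linarith [not_lt.mp hxB]⟩⟩
      · rw [if_neg hxin, if_neg hyin] at hne; exact absurd rfl hne
  have h := abs_sum_latticeCube_sub_integral_le_of_set (γ := γ) hr hrS
    (integrableOn_wDeriv_normForm hX hτ m a hS₀.le) zero_le_one hB hTm hTfin hgT
  refine h.trans ?_
  have hr3 : (0 : ℝ) < (r : ℝ) ^ 3 := by positivity
  calc ((r : ℝ) ^ 3)⁻¹ * (2 * 1 * (volume T).toReal) + 108 * (S₀ / r) ^ 2 * 1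
      ≤ ((r : ℝ) ^ 3)⁻¹ * (2 * 1 * (1404 * (c₃ ^ 3 / c₄) * r * S₀ ^ 2)) + 108 * (S₀ / r) ^ 2 * 1 := by
        gcongr
    _ = (2808 * (c₃ ^ 3 / c₄) + 108) * (S₀ ^ 2 / r ^ 2) := by
        field_simp
        ring

end EightFiveZero

end Literature.NumberTheory.Sieve.CubicSieve

end
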